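import Summits.SmoothPoincare4.SmoothPoincare4.Theses.SullivanDual
import Literature.Geometry.Symplectic.JHolomorphicMap
import Summits.SmoothPoincare4.SmoothPoincare4.Theorems.SullivanDualHyperbolicEndSPC4Case
import Literature.Geometry.Symplectic.GromovMcDuffTwistedSphereProofs

/-!
# Crux idea `taubes-circle-pencil` — first lemmas (planner sketch, crux `HyperbolicEnd`,
route `SullivanDual`, ideator k = 4, round 2, 2026-08-17)

Two typed statements of the line "sweep the near-symplectic core by Gromov's line pencil through
Taubes' zero circle":

* `NoWitnessOffDefect` — the EASY half of the dichotomy (first checkable lemma): if a smooth `J` on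
  `Σ ∖ p` is tamed, off an open set `N`, by a smooth CLOSED 2-form `ω` (on `Σ ∖ p ≃ *` closed = exact),
  then no witness of the crux (non-constant entire `J`-curve avoiding the `ε`-ball) avoids `N`:
  Brody + Ahlfors current `T`, `T(ω) = T(dλ) = 0` against `T(ω) > 0` by uniform taming on the compact
  `K_ε ∖ N`.  With `ω` near-symplectic and `N` a thin neighbourhood of its zero circles `Z`, every
  witness of every near-tame `J` is slaved to `Z`.
* `RelNearSymplecticExists` — the Σ-blind existence input (Taubes–Luttinger; Gerig AGT 2021 Thm 1.6 +
  Perutz JSG 2006): `Σ ∖ p` carries a smooth closed 2-form, equal to the inverted-chart model `ι*ω₀`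
  on a punctured chart ball, non-degenerate off the image of two smoothly embedded circles on which it
  vanishes (transversality of the vanishing — rank 3 of `∇ω` along `Z` — is deliberately not typed here;
  crux-plan should vendor `IsNearSymplectic`).

Neither is the crux; the crux-level transfer target `PencilTransparency` (the compactified degree-1
moduli space through `p∞` is a 2-sphere of pairwise disjoint leaves off `p∞ ∪ Z`) needs SFT vocabulary
the tree does not have and stays informal on the card.
-/

namespace Summit.SmoothPoincare4.SmoothPoincare4.Cruxes.HyperbolicEnd.TaubesCirclePencil

open scoped Manifold ContDiff Topology
open Literature.Geometry.Symplectic Literature.Geometry.Kaehler Literature.Topology.FourManifolds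

/-- FIRST LEMMA (easy half of the dichotomy; true for every homotopy sphere, every `J`).
If `J² = −1` on `Σ ∖ p`, `J` smooth, `ω` a smooth closed 2-form taming `J` at every point outside an
open set `N`, then there is no non-constant `C^∞` `J`-holomorphic `u : ℂ → Σ ∖ p` avoiding both the
punctured `ε`-chart-ball and `N`.  (Proof on paper: the image lies in the compact `K_ε ∩ Nᶜ`, where the
taming is uniform; Brody reparametrisation gives a curve with bounded derivative, Ahlfors gives a closed
positive current `T` of mass 1 supported there; `H²_dR(Σ ∖ p) = 0` makes `ω = dλ`, so
`0 = T(dλ) = ∫ ω(T⃗) dμ_T > 0`.) -/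
def NoWitnessOffDefect : Prop :=
  ∀ (S : HomotopySphere 4) (p : S.carrier)
    (J : ∀ x : ↥(punctured p), TangentSpace (𝓡 4) x →L[ℝ] TangentSpace (𝓡 4) x)
    (sf : MForm (𝓡 4) ↥(punctured p) ℝ 2) (N : Set ↥(punctured p)) (ε : ℝ), 0 < ε → IsOpen N →
    (∀ (x : ↥(punctured p)) (v : TangentSpace (𝓡 4) x), J x (J x v) = -v) →
    (∀ x₀ : ↥(punctured p), ContMDiffAt (𝓡 4) 𝓘(ℝ, EuclideanSpace ℝ (Fin 4) →L[ℝ] EuclideanSpace ℝ (Fin 4)) ∞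
      (inTangentCoordinates (𝓡 4) (𝓡 4) (id : ↥(punctured p) → ↥(punctured p)) id (fun x => J x) x₀) x₀) →
    IsSmoothForm sf → IsClosedForm sf →
    (∀ x : ↥(punctured p), x ∉ N → ∀ v : TangentSpace (𝓡 4) x, v ≠ 0 → 0 < sf x ![v, J x v]) →
    ¬ ∃ u : ℂ → ↥(punctured p),
      (ContMDiff 𝓘(ℝ, ℂ) (𝓡 4) ∞ u ∧ (∃ z z' : ℂ, u z ≠ u z') ∧
        (∀ z ζ : ℂ, mfderiv 𝓘(ℝ, ℂ) (𝓡 4) u z (Complex.I * ζ : ℂ) =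
          J (u z) (mfderiv 𝓘(ℝ, ℂ) (𝓡 4) u z (ζ : ℂ))) ∧
        (∀ z : ℂ, ¬ InPuncturedChartBall p ε (u z)) ∧ (∀ z : ℂ, u z ∉ N))

/-- Consistency check of the shape: with `N = ∅` (a globally tamed `J`) the first lemma gives
exactly the "no witness at radius `ε`" clause of `HyperbolicEnd` — the `Σ = S⁴` mechanism
(`J = Φ*i` tamed by `Φ*ω₀`). -/
theorem noWitness_of_tame (h : NoWitnessOffDefect) (S : HomotopySphere 4) (p : S.carrier)
    (J : ∀ x : ↥(punctured p), TangentSpace (𝓡 4) x →L[ℝ] TangentSpace (𝓡 4) x)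
    (sf : MForm (𝓡 4) ↥(punctured p) ℝ 2) (ε : ℝ) (hε : 0 < ε)
    (hJ2 : ∀ (x : ↥(punctured p)) (v : TangentSpace (𝓡 4) x), J x (J x v) = -v)
    (hJs : ∀ x₀ : ↥(punctured p), ContMDiffAt (𝓡 4) 𝓘(ℝ, EuclideanSpace ℝ (Fin 4) →L[ℝ] EuclideanSpace ℝ (Fin 4)) ∞
      (inTangentCoordinates (𝓡 4) (𝓡 4) (id : ↥(punctured p) → ↥(punctured p)) id (fun x => J x) x₀) x₀)
    (hsfs : IsSmoothForm sf) (hsfc : IsClosedForm sf)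
    (htame : ∀ (x : ↥(punctured p)) (v : TangentSpace (𝓡 4) x), v ≠ 0 → 0 < sf x ![v, J x v]) :
    ¬ ∃ u : ℂ → ↥(punctured p),
      (ContMDiff 𝓘(ℝ, ℂ) (𝓡 4) ∞ u ∧ (∃ z z' : ℂ, u z ≠ u z') ∧
        (∀ z ζ : ℂ, mfderiv 𝓘(ℝ, ℂ) (𝓡 4) u z (Complex.I * ζ : ℂ) =
          J (u z) (mfderiv 𝓘(ℝ, ℂ) (𝓡 4) u z (ζ : ℂ))) ∧
        (∀ z : ℂ, ¬ InPuncturedChartBall p ε (u z))) := by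
  intro ⟨u, hu, hne, hhol, havoid⟩
  refine h S p J sf ∅ ε hε isOpen_empty hJ2 hJs hsfs hsfc (fun x _ v hv => htame x v hv)
    ⟨u, hu, hne, hhol, havoid, fun z => Set.notMem_empty _⟩

/-- Σ-BLIND EXISTENCE INPUT (Taubes–Luttinger; Gerig, AGT 21 (2021) Thm 1.6 and the circle-trading of
Perutz, JSG 4 (2006)): on `Σ ∖ p` there is a smooth closed 2-form equal to the inverted-chart model on a
punctured chart ball, vanishing exactly on the image of two smoothly embedded circles (two UNTWISTED
zero circles; parity forbids one untwisted circle) away from that ball, and non-degenerate elsewhere.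
Transverse vanishing along the circles is part of the printed statement and is NOT typed here. -/
def RelNearSymplecticExists : Prop :=
  ∀ (S : HomotopySphere 4) (p : S.carrier), ∃ ε : ℝ, 0 < ε ∧
    Metric.closedBall (extChartAt (𝓡 4) p p) ε ⊆ (extChartAt (𝓡 4) p).target ∧
    ∃ sf : MForm (𝓡 4) ↥(punctured p) ℝ 2, IsSmoothForm sf ∧ IsClosedForm sf ∧
      (∀ x : ↥(punctured p), InPuncturedChartBall p ε x → ∀ v w : TangentSpace (𝓡 4) x,
        sf x ![v, w] = invertedStdForm (extChartAt (𝓡 4) p x.1 - extChartAt (𝓡 4) p p)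
          (mfderiv (𝓡 4) 𝓘(ℝ, EuclideanSpace ℝ (Fin 4)) (fun z : ↥(punctured p) => extChartAt (𝓡 4) p z.1) x v)
          (mfderiv (𝓡 4) 𝓘(ℝ, EuclideanSpace ℝ (Fin 4)) (fun z : ↥(punctured p) => extChartAt (𝓡 4) p z.1) x w)) ∧
      ∃ γ : (↥(Metric.sphere (0 : EuclideanSpace ℝ (Fin 2)) 1) ⊕ ↥(Metric.sphere (0 : EuclideanSpace ℝ (Fin 2)) 1)) →
          ↥(punctured p),
        Function.Injective γ ∧ ContMDiff (𝓡 1) (𝓡 4) ∞ γ ∧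
        (∀ x : ↥(punctured p), sf x = 0 ↔ x ∈ Set.range γ) ∧
        (∀ x : ↥(punctured p), x ∉ Set.range γ → ∀ v : TangentSpace (𝓡 4) x, v ≠ 0 →
          ∃ w : TangentSpace (𝓡 4) x, sf x ![v, w] ≠ 0) ∧
        (∀ x : ↥(punctured p), x ∈ Set.range γ → ¬ InPuncturedChartBall p ε x)

/-- LANDED END-GAME OF THE LINE (kernel-checked composition, no new mathematics): the output of a
transparent pencil is a diffeomorphism `Φ : Σ ∖ p ≃ₘ ℝ⁴` agreeing with the inverted chart near `p`
(exactly the conclusion shape of `GromovChartForm`); the tree already turns this into the crux AT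
`(S, p)`: glue over `p` (`Literature.Geometry.Symplectic.sympcap_glue_chartStandardEnd`, item 0443)
and pull back the model hyperbolic pair (`hyperbolicEndAt_of_nonempty_diffeomorph_sphere`, SPC4Case
p113806).  So the line's last arrow `PencilTransparency(Σ,p) → HyperbolicEndAt(Σ,p)` costs nothing
beyond `PencilTransparency(Σ,p) → ∃ Φ, AgreesWithInvertedChartNear p Φ` (Thm S §4 end control). -/
theorem hyperbolicEndAt_of_chartForm (S : HomotopySphere 4) (p : S.carrier)
    (hΦ : ∃ Φ : (punctured p) ≃ₘ⟮𝓡 4, 𝓡 4⟯ EuclideanSpace ℝ (Fin 4), AgreesWithInvertedChartNear p ⇑Φ) :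
    ∃ (J : ∀ x : ↥(Literature.Geometry.Symplectic.punctured p), TangentSpace (𝓡 4) x →L[ℝ] TangentSpace (𝓡 4) x) (ε' : ℝ), 0 < ε' ∧ Metric.closedBall (extChartAt (𝓡 4) p p) ε' ⊆ (extChartAt (𝓡 4) p).target ∧ (∀ (x : ↥(Literature.Geometry.Symplectic.punctured p)) (v : TangentSpace (𝓡 4) x), J x (J x v) = -v) ∧ (∀ x₀ : ↥(Literature.Geometry.Symplectic.punctured p), ContMDiffAt (𝓡 4) 𝓘(ℝ, EuclideanSpace ℝ (Fin 4) →L[ℝ] EuclideanSpace ℝ (Fin 4)) ∞ (inTangentCoordinates (𝓡 4) (𝓡 4) (id : ↥(Literature.Geometry.Symplectic.punctured p) → ↥(Literature.Geometry.Symplectic.punctured p)) id (fun x => J x) x₀) x₀) ∧ (∀ x : ↥(Literature.Geometry.Symplectic.punctured p), Literature.Geometry.Symplectic.InPuncturedChartBall p ε' x → ∀ (v : TangentSpace (𝓡 4) x) (b : EuclideanSpace ℝ (Fin 4)), inner ℝ (fderiv ℝ Literature.Geometry.Symplectic.inversion (extChartAt (𝓡 4) p x.1 - extChartAt (𝓡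 4) p p) (mfderiv (𝓡 4) 𝓘(ℝ, EuclideanSpace ℝ (Fin 4)) (fun z : ↥(Literature.Geometry.Symplectic.punctured p) => extChartAt (𝓡 4) p z.1) x (J x v))) b = Literature.Geometry.Symplectic.stdSymplecticForm (fderiv ℝ Literature.Geometry.Symplectic.inversion (extChartAt (𝓡 4) p x.1 - extChartAt (𝓡 4) p p) (mfderiv (𝓡 4) 𝓘(ℝ, EuclideanSpace ℝ (Fin 4)) (fun z : ↥(Literature.Geometry.Symplectic.punctured p) => extChartAt (𝓡 4) p z.1) x v)) b) ∧ ∀ ε : ℝ, 0 < ε → ε < ε' → ¬ ∃ u : ℂ → ↥(Literature.Geometry.Symplectic.punctured p), (ContMDiff 𝓘(ℝ, ℂ) (𝓡 4) ∞ u ∧ (∃ z z' : ℂ, u z ≠ u z') ∧ (∀ z ζ : ℂ, mfderiv 𝓘(ℝ, ℂ) (𝓡 4) u z (Complex.I * ζ : ℂ) = J (u z) (mfderiv 𝓘(ℝ, ℂ) (𝓡 4) u z (ζ : ℂ))) ∧ (∀ z : ℂ, ¬ Literature.Geometry.Symplectic.InPuncturedChartBall p ε (u z))) := by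
  obtain ⟨Φ, hΦ'⟩ := hΦ
  exact Summit.SmoothPoincare4.SmoothPoincare4.Cruxes.HyperbolicEnd.Sketch.hyperbolicEndAt_of_nonempty_diffeomorph_sphere
    S p (Literature.Geometry.Symplectic.sympcap_glue_chartStandardEnd S p Φ hΦ')

end Summit.SmoothPoincare4.SmoothPoincare4.Cruxes.HyperbolicEnd.TaubesCirclePencil
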